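import Summits.CriticalPhenomena.CardyFormulaZ2.Theses.CardyMeckeFlip

/-!
# Route CardyMeckeFlip — Assembly (item stmt-CriticalPhenomena-14830)

The assembly item of route `CardyMeckeFlip` of the sub-problem `CardyFormulaZ2`:

  `MeckeRigidity → FlipErgodicityZ2 → Z2LimitsSymmetric → LawToCrossings → CardyFormulaZ2`.

This is literally the route's deciding theorem `closes`, and the proof is its term:

* law level (the glue item `CruxesToSublimitsCardy`, proved here as
  `cardyMeckeFlip_cruxesToSublimitsCardy`): for `μ ∈ subseqQuadLimits univ`,
  `Z2LimitsSymmetric` gives `(prob, E2, D, c, RSW)`, `FlipErgodicityZ2` — instantiated at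
  `Piv :=` its defining predicate (proof `Iff.rfl`) — gives an admissible flip-fair kernel family
  `M` for which `μ` is extremal, and `MeckeRigidity` at the same `Piv` applied to `(μ, M)` returns
  the Cardy crossing values: this is `SublimitsCardy`;
* statement level: `LawToCrossings` turns `SublimitsCardy` into convergence of
  `bondDomainCrossingProb R` along a subsequence of every mesh sequence `u → 0⁺`, and since
  `𝓝[>] 0` is countably generated, `Filter.tendsto_of_subseq_tendsto` upgrades this to
  `R.HasCrossingLimit (bondDomainCrossingProb R) cardyFunction` for every conformal rectangle `R`,
  i.e. `CardyFormulaZ2`.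

All mathematical content sits in the four hypotheses; nothing is assumed here.
-/

namespace Summit.CriticalPhenomena.CardyFormulaZ2.Theorems

open Summit.CriticalPhenomena.CardyFormulaZ2.Theses.CardyMeckeFlip

/-- **Glue of route CardyMeckeFlip** (the support item `CruxesToSublimitsCardy`,
stmt-CriticalPhenomena-14160, used here as the first step of the assembly): the three law-level
cruxes imply the law-level target, `MeckeRigidity → FlipErgodicityZ2 → Z2LimitsSymmetric →
SublimitsCardy`.  Pure logic: for `μ ∈ subseqQuadLimits univ` take `(prob, E2, D, c, RSW)` from
`Z2LimitsSymmetric`, the admissible flip-fair extremal kernel family `M` from `FlipErgodicityZ2`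
at `Piv :=` its defining predicate (`Iff.rfl`), and apply `MeckeRigidity` at the same `Piv` to
`(μ, M)`. -/
theorem cardyMeckeFlip_cruxesToSublimitsCardy :
    Summit.CriticalPhenomena.CardyFormulaZ2.Theses.CardyMeckeFlip.CruxesToSublimitsCardy := by
  unfold Summit.CriticalPhenomena.CardyFormulaZ2.Theses.CardyMeckeFlip.CruxesToSublimitsCardy
  intro hK2 hK3 hS μ hμ
  obtain ⟨hprob, hsym, hdual, c, hc, hrsw⟩ := hS μ hμ
  -- `Piv := its defining predicate` is found by unification from `Iff.rfl`
  obtain ⟨M, hadm, hff, hext⟩ := hK3 _ (fun _ _ _ => Iff.rfl) μ hμ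
  exact hK2 _ (fun _ _ _ => Iff.rfl) _ M hprob hsym hdual c hc hrsw hadm hff hext

/-- **Assembly of route CardyMeckeFlip** (item stmt-CriticalPhenomena-14830): the chain
`MeckeRigidity → FlipErgodicityZ2 → Z2LimitsSymmetric → LawToCrossings → CardyFormulaZ2` holds —
the three law-level cruxes give `SublimitsCardy` (`cardyMeckeFlip_cruxesToSublimitsCardy`),
`LawToCrossings` gives convergence of the bond-`ℤ²` crossing probabilities along a subsequence of
every mesh sequence, and `Filter.tendsto_of_subseq_tendsto` (`𝓝[>] 0` is countably generated)
gives the full one-sided limit, i.e. `CardyFormulaZ2`.  This is the term of the route's deciding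
theorem `closes`. -/
theorem cardyMeckeFlip_assembly_proof :
    Summit.CriticalPhenomena.CardyFormulaZ2.Theses.CardyMeckeFlip.Assembly := by
  unfold Summit.CriticalPhenomena.CardyFormulaZ2.Theses.CardyMeckeFlip.Assembly
  intro hK2 hK3 hS hB
  -- layer 2 → layer 1 (law level)
  have hT : SublimitsCardy := cardyMeckeFlip_cruxesToSublimitsCardy hK2 hK3 hS
  -- layer 1 → Statement
  intro R φ x hφx
  refine Filter.tendsto_of_subseq_tendsto fun u hu => ?_
  obtain ⟨ψ, -, hconv⟩ := hB hT u hu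
  exact ⟨ψ, hconv R φ x hφx⟩

end Summit.CriticalPhenomena.CardyFormulaZ2.Theorems
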